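import Literature.Probability.RandomPlanarGeometry.HexSAWBrickWallStripFugacityWidthOneContactGaussianTails
import Literature.Probability.RandomPlanarGeometry.HexSAWBrickWallStripFugacityWidthOneContactModerateDeviations
import HarnessLib

/-!
# The cumulant generating function limit, and the top wall's Gaussian and moderate-deviation tails by reflection

Topic `Literature/Probability/RandomPlanarGeometry` (continues `…ContactGaussianMGF.lean` (`M_N(s) → e^{σ²s²/2}`), `…ContactGaussianTails.lean`
(CLT-scale tails of `bc`), `…ContactModerateDeviations.lean` (uniform log-mgf expansion, moderate deviations of `bc`) and `…FugacitySymmetric.lean`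
(`stripZ₂_symm`, `sum_filter_topVisits_eq_sum_filter_bottomVisits`: the reflection exchanging the walls)).

* §1 ★★ `tendsto_log_contactMGF`: `log E_{N,y,z} e^{s(bc − Nb)/√N} → σ²s²/2` — convergence of the cumulant generating functions (the form in which
  the Gärtner–Ellis / Bryc machinery consumes the input), and its top-wall twin `tendsto_log_topContactMGF`.
* §2 the TOP wall by reflection: ★★ `eventually_topContactUpperTail_le` / `eventually_topContactLowerTail_le`
  (`P_{N,y,z}(tc ≷ N b(z,y) ± x√N) ≤ e^{−x²/(2σ_top²)} + ε`, `σ_top² = d/dB b(e^B,y)|_{log z}`), ★★ `eventually_topContactUpperTail_le_exp_moderate` /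
  `eventually_topContactLowerTail_le_exp_moderate` (moderate deviations of `tc` with the Gaussian rate).

## Sources
A. Dembo, O. Zeitouni (2010) §2.3, §3.7 (lane statements); N. R. Beaton et al., CMP 326 (2014), arXiv:1109.0358v5 §3.2 Proposition 6 (p. 10: symmetry
clause — the reflection); N. Madras, G. Slade (1993) §1.1.  Nothing is quoted AS PRINTED.
-/

noncomputable section

open Filter Topology Finset Set Literature.Analysis
open Literature.Probability.LatticeModels Literature.Probability.Percolation

namespace Literature.Probability.RandomPlanarGeometry.SAW.HexBW

namespace WidthOneYZ

variable {y z : ℝ}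

/-! ## §1 The cumulant generating functions converge -/

/-- ★★ **CONVERGENCE OF THE CUMULANT GENERATING FUNCTIONS**: for all `y, z > 0` and every real `s`,
`log (C_{1,N}(y e^{s/√N},z)/C_{1,N}(y,z) · e^{−s√N b}) → σ²s²/2`. [cite: DemboZeitouni2010, §2.3 (Assumption 2.3.2: existence of the limiting logarithmic mgf; lane statement)] -/
theorem tendsto_log_contactMGF (hy : 0 < y) (hz : 0 < z) (s : ℝ) :
    Tendsto (fun N : ℕ => Real.log (stripZ₂ 1 N (y * Real.exp (s / Real.sqrt N)) z / stripZ₂ 1 N y z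
        * Real.exp (-(s * Real.sqrt N * contactB y z)))) atTop
      (𝓝 (deriv (fun A => contactB (Real.exp A) z) (Real.log y) * s ^ 2 / 2)) := by
  have h := tendsto_contactMGF_gaussian hy hz s
  have hpos : 0 < Real.exp (deriv (fun A => contactB (Real.exp A) z) (Real.log y) * s ^ 2 / 2) := Real.exp_pos _
  have := ((Real.continuousAt_log hpos.ne').tendsto).comp h
  rwa [Real.log_exp] at this

/-- ★★ The top wall: `log (C_{1,N}(y, z e^{s/√N})/C_{1,N}(y,z) · e^{−s√N b(z,y)}) → σ_top² s²/2`.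
[cite: DemboZeitouni2010, §2.3 (lane statement); BeatonBousquetMelouDeGierDuminilCopinGuttmann2014, §3.2 Proposition 6 (arXiv v5 p. 10: symmetry)] -/
theorem tendsto_log_topContactMGF (hy : 0 < y) (hz : 0 < z) (s : ℝ) :
    Tendsto (fun N : ℕ => Real.log (stripZ₂ 1 N y (z * Real.exp (s / Real.sqrt N)) / stripZ₂ 1 N y z
        * Real.exp (-(s * Real.sqrt N * contactB z y)))) atTop
      (𝓝 (deriv (fun B => contactB (Real.exp B) y) (Real.log z) * s ^ 2 / 2)) := by
  have h := tendsto_log_contactMGF hz hy s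
  refine h.congr fun N => ?_
  rw [stripZ₂_symm 1 N (z * Real.exp (s / Real.sqrt N)) y, stripZ₂_symm 1 N z y]

/-! ## §2 The top wall's tails by reflection -/

open Classical in
/-- ★★ **TOP WALL, GAUSSIAN UPPER TAIL AT THE CLT SCALE**: `P_{N,y,z}(tc ≥ N·b(z,y) + x√N) ≤ e^{−x²/(2σ_top²)} + ε` for all large `N`
(`σ_top² = d/dB b(e^B,y)|_{log z}`; reflection of `eventually_contactUpperTail_le`).
[cite: DemboZeitouni2010, §2.3 (lane statement); BeatonBousquetMelouDeGierDuminilCopinGuttmann2014, §3.2 Proposition 6 (arXiv v5 p. 10: symmetry)] -/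
theorem eventually_topContactUpperTail_le (hy : 0 < y) (hz : 0 < z) {x : ℝ} (hx : 0 < x) {ε : ℝ} (hε : 0 < ε) :
    ∀ᶠ N : ℕ in atTop,
      (∑ q ∈ (stripPairs 1 N).filter (fun q => (N : ℝ) * contactB z y + x * Real.sqrt N ≤ (topVisits₀ 1 q.1 q.2 N : ℝ)), wgt y z N q)
          / stripZ₂ 1 N y z
        ≤ Real.exp (-(x ^ 2 / (2 * deriv (fun B => contactB (Real.exp B) y) (Real.log z)))) + ε := by
  filter_upwards [eventually_contactUpperTail_le hz hy hx hε] with N hN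
  rw [sum_filter_topVisits_eq_sum_filter_bottomVisits y z N (fun k => (N : ℝ) * contactB z y + x * Real.sqrt N ≤ (k : ℝ)),
    stripZ₂_symm 1 N y z]
  exact hN

open Classical in
/-- ★★ **TOP WALL, GAUSSIAN LOWER TAIL AT THE CLT SCALE**: `P_{N,y,z}(tc ≤ N·b(z,y) − x√N) ≤ e^{−x²/(2σ_top²)} + ε` for all large `N`.
[cite: DemboZeitouni2010, §2.3 (lane statement); BeatonBousquetMelouDeGierDuminilCopinGuttmann2014, §3.2 Proposition 6 (arXiv v5 p. 10: symmetry)] -/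
theorem eventually_topContactLowerTail_le (hy : 0 < y) (hz : 0 < z) {x : ℝ} (hx : 0 < x) {ε : ℝ} (hε : 0 < ε) :
    ∀ᶠ N : ℕ in atTop,
      (∑ q ∈ (stripPairs 1 N).filter (fun q => (topVisits₀ 1 q.1 q.2 N : ℝ) ≤ (N : ℝ) * contactB z y - x * Real.sqrt N), wgt y z N q)
          / stripZ₂ 1 N y z
        ≤ Real.exp (-(x ^ 2 / (2 * deriv (fun B => contactB (Real.exp B) y) (Real.log z)))) + ε := by
  filter_upwards [eventually_contactLowerTail_le hz hy hx hε] with N hN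
  rw [sum_filter_topVisits_eq_sum_filter_bottomVisits y z N (fun k => (k : ℝ) ≤ (N : ℝ) * contactB z y - x * Real.sqrt N),
    stripZ₂_symm 1 N y z]
  exact hN

open Classical in
/-- ★★ **TOP WALL, MODERATE DEVIATIONS, UPPER TAIL**: for `x_N → ∞` with `x_N/√N → 0` and `η > 0`, for all large `N`,
`P_{N,y,z}(tc ≥ N·b(z,y) + x_N√N) ≤ exp(−(1−η)x_N²/(2σ_top²))`. [cite: DemboZeitouni2010, §3.7 (moderate deviations; lane statement); BeatonBousquetMelouDeGierDuminilCopinGuttmann2014, §3.2 Proposition 6 (arXiv v5 p. 10: symmetry)] -/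
theorem eventually_topContactUpperTail_le_exp_moderate (hy : 0 < y) (hz : 0 < z) {x : ℕ → ℝ} (hx : Tendsto x atTop atTop)
    (hxN : Tendsto (fun N => x N / Real.sqrt N) atTop (𝓝 0)) {η : ℝ} (hη : 0 < η) :
    ∀ᶠ N : ℕ in atTop,
      (∑ q ∈ (stripPairs 1 N).filter (fun q => (N : ℝ) * contactB z y + x N * Real.sqrt N ≤ (topVisits₀ 1 q.1 q.2 N : ℝ)), wgt y z N q)
          / stripZ₂ 1 N y z
        ≤ Real.exp (-((1 - η) * x N ^ 2 / (2 * deriv (fun B => contactB (Real.exp B) y) (Real.log z)))) := by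
  filter_upwards [eventually_contactUpperTail_le_exp_moderate hz hy hx hxN hη] with N hN
  rw [sum_filter_topVisits_eq_sum_filter_bottomVisits y z N (fun k => (N : ℝ) * contactB z y + x N * Real.sqrt N ≤ (k : ℝ)),
    stripZ₂_symm 1 N y z]
  exact hN

open Classical in
/-- ★★ **TOP WALL, MODERATE DEVIATIONS, LOWER TAIL**: for `x_N → ∞` with `x_N/√N → 0` and `η > 0`, for all large `N`,
`P_{N,y,z}(tc ≤ N·b(z,y) − x_N√N) ≤ exp(−(1−η)x_N²/(2σ_top²))`. [cite: DemboZeitouni2010, §3.7 (moderate deviations; lane statement); BeatonBousquetMelouDeGierDuminilCopinGuttmann2014, §3.2 Proposition 6 (arXiv v5 p. 10: symmetry)] -/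
theorem eventually_topContactLowerTail_le_exp_moderate (hy : 0 < y) (hz : 0 < z) {x : ℕ → ℝ} (hx : Tendsto x atTop atTop)
    (hxN : Tendsto (fun N => x N / Real.sqrt N) atTop (𝓝 0)) {η : ℝ} (hη : 0 < η) :
    ∀ᶠ N : ℕ in atTop,
      (∑ q ∈ (stripPairs 1 N).filter (fun q => (topVisits₀ 1 q.1 q.2 N : ℝ) ≤ (N : ℝ) * contactB z y - x N * Real.sqrt N), wgt y z N q)
          / stripZ₂ 1 N y z
        ≤ Real.exp (-((1 - η) * x N ^ 2 / (2 * deriv (fun B => contactB (Real.exp B) y) (Real.log z)))) := by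
  filter_upwards [eventually_contactLowerTail_le_exp_moderate hz hy hx hxN hη] with N hN
  rw [sum_filter_topVisits_eq_sum_filter_bottomVisits y z N (fun k => (k : ℝ) ≤ (N : ℝ) * contactB z y - x N * Real.sqrt N),
    stripZ₂_symm 1 N y z]
  exact hN

end WidthOneYZ

end Literature.Probability.RandomPlanarGeometry.SAW.HexBW
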